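/-
Copyright: harness tree, Literature layer (sorry-free). b2b-lace enum1-g34 (ENUMERATION SHARD A gen 34),
D10-HYBRID census node D10H-1b: semantics of the dimension-parametric SEEDCERT evaluator.
-/
import Literature.Probability.FitznerVanDerHofstad2017.SrwSeedCertKernelD
import Literature.Probability.FitznerVanDerHofstad2017.SrwSeedCertSemantics

/-!
# SEEDCERT kernel evaluator, dimension-parametric: semantics of the walk-count layer

The dimension-parametric companion of the `Cert` section of `SrwSeedCertSemantics`: for a certificate
`c : SeedCert.Cert` and a dimension `D` (`c.ParamsD D`, unpacked from `c.paramsOKD D` by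
`Cert.paramsD_of_paramsOKD`), the hat half-table `c.whatD D` is `M̂!·G_D(2k+A)/(2k+A)!`
(`Cert.whatD_spec`, from the dimension-free `wHatFold_spec`), and the Horner sums with base `(2D)²`
(`hornerAuxB_eq`) are the truncated walk sums: **`Cert.PqD_real` / `Cert.UqD_real`**,
`P_n = Σ_{m<M n} C(m+n',n') p_m(x; D)` and `U_n = Σ_{m<M n} C(m+n',n') p_m(x; D) E_{m+n'+1}(λ)` with
`p_m = srwLaw D m x` (`srwLaw_eq_srwCount_div`) and `λ = D t²`, for `x : ℤ^D` the padded coordinate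
vector of the certificate.  All list-kernel semantics (`toPolyN_loProdPN`, `tailInt_eq`, `facSeq_getD`,
`expSeq_getD`, `sum_range_parity`, …) are imported from `SrwSeedCertSemantics`; nothing is evaluated by
the kernel here and there is no analysis (that is `SrwSeedCertSoundD`).

[cite: FitznerVanDerHofstad2016NoBLE, §5.1.1 (5.4)–(5.5) pp. 1089–1090]
-/

namespace Literature.Probability.FitznerVanDerHofstad2017.SeedCert

open Finset
open scoped Nat
open SrwCount (coordD G srwCount srwLaw_eq_srwCount_div)
open Literature.Barriers.CriticalPhenomena.LongRangePhi4 (srwLaw)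

/-! ### Horner with a base parameter -/

/-- `hornerAuxB B w f acc = acc·B^{|f|} + Σ_{i<|f|} w_i f_i B^{|f|-1-i}` (`|f| ≤ |w|`). [folklore] -/
private theorem hornerAuxB_eq (B : ℕ) : ∀ (w f : List ℕ) (acc : ℕ), f.length ≤ w.length →
    hornerAuxB B w f acc = acc * B ^ f.length
      + ∑ i ∈ range f.length, w.getD i 0 * f.getD i 0 * B ^ (f.length - 1 - i)
  | [], [], acc, _ => by simp [hornerAuxB]
  | _ :: _, [], acc, _ => by simp [hornerAuxB]
  | [], f :: fs, acc, h => by simp at h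
  | w :: ws, f :: fs, acc, h => by
      rw [hornerAuxB, hornerAuxB_eq B ws fs _ (by simpa using h)]
      simp only [List.length_cons]
      rw [sum_range_succ']
      simp only [List.getD_cons_succ, List.getD_cons_zero]
      have e1 : ∀ i, fs.length + 1 - 1 - (i + 1) = fs.length - 1 - i := by intro i; omega
      simp only [e1, show fs.length + 1 - 1 - 0 = fs.length by omega, pow_succ]
      ring

namespace Cert

variable (c : Cert) (D : ℕ)

/-- The facts packed in `paramsOKD`. [cite: FitznerVanDerHofstad2016NoBLE, §5.1.1 (5.4)–(5.5) pp. 1089–1090] -/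
structure ParamsD : Prop where
  s0_pos : 0 < c.s0
  s0_lt : c.s0 < 1
  hT : ((c.J : ℚ) + 3 / 2) / (2 * c.s0 ^ 2) ≤ (c.t : ℚ) ^ 2
  t_pos : 0 < c.t
  hMh : c.Mh = 2 * c.K + c.A
  hlen : c.coords.length ≤ D
  hD : 9 ≤ D
  nexp_pos : 0 < c.nexp
  sLo_pos : 0 < c.sLo
  sLo_sq : c.sLo ^ 2 ≤ 2 * piLo
  sHi_pos : 0 < c.sHi
  sHi_sq : 2 * piHi ≤ c.sHi ^ 2
  eLo_nonneg : 0 ≤ expNegOneLo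
  eps_nonneg : ∀ a ∈ c.avalsD D, 0 ≤ c.eps a
  eps_ge : ∀ a ∈ c.avalsD D, epsBoundQ a c.J c.s0 c.t c.sHi c.nexp ≤ c.eps a
  floor_nonneg : ∀ a ∈ c.avalsD D, 0 ≤ loFloor a c.J (c.eps a) c.h
  lo_dy : ∀ a ∈ c.avalsD D, ∀ q ∈ loList a c.J (c.eps a), dyadicOK c.S q = true
  up_dy : ∀ a ∈ c.avalsD D, ∀ q ∈ upList a c.J (c.eps a), dyadicOK c.S q = true
  M_pos : ∀ n, 1 ≤ n → n ≤ 4 → 1 ≤ c.M n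
  M_le : ∀ n, 1 ≤ n → n ≤ 4 → c.M n ≤ c.Mh + 1
  cnt_le : ∀ n, 1 ≤ n → n ≤ 4 → c.cnt n ≤ c.K + 1
  lam_lt : ∀ n, 1 ≤ n → n ≤ 4 → c.lamD D + 1 < c.M n

/-- Unpacking of the Boolean parameter check. [cite: FitznerVanDerHofstad2016NoBLE, §5.1.1 (5.4)–(5.5) pp. 1089–1090] -/
theorem paramsD_of_paramsOKD (h : c.paramsOKD D = true) : c.ParamsD D := by
  simp only [paramsOKD, Bool.and_eq_true, decide_eq_true_eq, List.all_eq_true, beq_iff_eq,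
    List.mem_range] at h
  obtain ⟨⟨⟨⟨⟨⟨⟨⟨⟨⟨⟨⟨⟨⟨h1, h2⟩, h3⟩, h4⟩, h5⟩, h6⟩, h6'⟩, h7⟩, h8⟩, h9⟩, h10⟩, h11⟩, h12⟩, h13⟩, h14⟩ := h
  have hn : ∀ n, 1 ≤ n → n ≤ 4 →
      1 ≤ c.M n ∧ c.M n ≤ c.Mh + 1 ∧ c.cnt n ≤ c.K + 1 ∧ c.lamD D + 1 < c.M n := by
    intro n hn1 hn4
    obtain ⟨⟨⟨a1, a2⟩, a3⟩, a4⟩ := h14 (n - 1) (by omega)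
    rw [show n - 1 + 1 = n by omega] at a1 a2 a3 a4
    exact ⟨a1, a2, a3, a4⟩
  exact ⟨h1, h2, h3, h4, h5, h6, h6', h7, h8, h9, h10, h11, h12,
    fun a ha => (h13 a ha).1.1.1.1, fun a ha => (h13 a ha).1.1.1.2, fun a ha => (h13 a ha).1.1.2,
    fun a ha => (h13 a ha).1.2, fun a ha => (h13 a ha).2,
    fun n h1 h4 => (hn n h1 h4).1, fun n h1 h4 => (hn n h1 h4).2.1, fun n h1 h4 => (hn n h1 h4).2.2.1,
    fun n h1 h4 => (hn n h1 h4).2.2.2⟩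

/-- The padded coordinate list has length `D`. [cite: FitznerVanDerHofstad2016NoBLE, §5.1.1 (5.4)–(5.5) pp. 1089–1090] -/
theorem length_avalsD (hp : c.ParamsD D) : (c.avalsD D).length = D := by
  simp [avalsD]; have := hp.hlen; omega

/-- Its sum is `A`. [cite: FitznerVanDerHofstad2016NoBLE, §5.1.1 (5.4)–(5.5) pp. 1089–1090] -/
theorem sum_avalsD : (c.avalsD D).sum = c.A := by
  simp [avalsD, A]

/-- Its entries are the listed coordinates (zero beyond). [cite: FitznerVanDerHofstad2016NoBLE, §5.1.1 (5.4)–(5.5) pp. 1089–1090] -/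
theorem getD_avalsD (i : ℕ) : (c.avalsD D).getD i 0 = c.coords.getD i 0 := by
  simp only [avalsD, List.getD_eq_getElem?_getD]
  rcases lt_or_ge i c.coords.length with h | h
  · rw [List.getElem?_append_left h]
  · rw [List.getElem?_append_right h, List.getElem?_eq_none h]
    simp only [List.getElem?_replicate]
    split <;> simp

variable {c D}
variable {x : Fin D → ℤ}

/-- The hat table of the certificate in dimension `D`. [cite: FitznerVanDerHofstad2016NoBLE, §5.1.1 (5.4)–(5.5) pp. 1089–1090] -/
theorem whatD_spec (hp : c.ParamsD D) (hcs : ∀ i, coordD x i = (((c.avalsD D).getD i 0 : ℕ) : ℤ)) :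
    (c.whatD D).length = c.K + 1 ∧ ∀ k ≤ c.K, (((c.whatD D).getD k 0 : ℕ) : ℚ)
      = (c.Mh ! : ℚ) * (G x D (2 * k + c.A) : ℚ) / ((2 * k + c.A)! : ℚ) := by
  have h := wHatFold_spec hcs (Mh := c.Mh) (K := c.K) (by rw [sum_avalsD, hp.hMh])
  rw [length_avalsD c D hp, sum_avalsD] at h
  exact h

/-- `A_D` of the padded list is `A`. [cite: FitznerVanDerHofstad2016NoBLE, §5.1.1 (5.4)–(5.5) pp. 1089–1090] -/
theorem Asum_avalsD (hp : c.ParamsD D) : Asum (c.avalsD D) D = c.A := by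
  have h := Asum_length (c.avalsD D)
  rw [length_avalsD c D hp, sum_avalsD] at h
  exact h

/-- The power bookkeeping of the Horner base: `((2D)²)^(K+1-cnt) · ((2D)²)^(cnt-1-i) · (2D)^(2i+A) = (2D)^{M̂}`
for `i < cnt ≤ K+1`, `M̂ = 2K + A`. [cite: FitznerVanDerHofstad2016NoBLE, §5.1.1 (5.4)–(5.5) pp. 1089–1090] -/
theorem baseD_pow_bookkeeping (hp : c.ParamsD D) {n i : ℕ} (hcnt : c.cnt n ≤ c.K + 1) (hi : i < c.cnt n) :
    ((baseD D : ℕ) : ℚ) ^ (c.K + 1 - c.cnt n) * ((baseD D : ℕ) : ℚ) ^ (c.cnt n - 1 - i)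
        * (((2 * D : ℕ) : ℚ)) ^ (2 * i + c.A)
      = (((2 * D : ℕ) : ℚ)) ^ c.Mh := by
  have hMh := hp.hMh
  rw [baseD]
  push_cast
  rw [← pow_mul, ← pow_mul, ← pow_add, ← pow_add]
  congr 1; omega

/-- **`P_n` is the truncated walk sum** `Σ_{m<M n} C(m+n', n') G_D(m)/(2D)^m`. [cite: FitznerVanDerHofstad2016NoBLE, §5.1.1 (5.4)–(5.5) pp. 1089–1090] -/
theorem PqD_eq (hp : c.ParamsD D) (hcs : ∀ i, coordD x i = (((c.avalsD D).getD i 0 : ℕ) : ℤ))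
    (n : ℕ) (hn1 : 1 ≤ n) (hn4 : n ≤ 4) :
    c.PqD D (c.whatD D) n = ∑ m ∈ range (c.M n),
      (((m + (n - 1)).choose (n - 1) : ℕ) : ℚ) * (G x D m : ℚ) / (((2 * D : ℕ) : ℚ)) ^ m := by
  obtain ⟨hwl, hwv⟩ := whatD_spec hp hcs
  have hcnt := hp.cnt_le n hn1 hn4
  have hD0 : (((2 * D : ℕ) : ℚ)) ≠ 0 := by have := hp.hD; positivity
  rw [PqD, NPD, denD, hornerB, hornerAuxB_eq _ _ _ _ (by rw [length_facSeq, hwl]; exact hcnt),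
    length_facSeq, zero_mul, zero_add, prodRange_zero]
  -- reindex the right-hand side over the parity lattice
  have hre := sum_range_parity hcs D (c.M n)
    (fun m => (((m + (n - 1)).choose (n - 1) : ℕ) : ℚ) / (((2 * D : ℕ) : ℚ)) ^ m)
  rw [Asum_avalsD hp] at hre
  have hrhs : ∑ m ∈ range (c.M n),
      (((m + (n - 1)).choose (n - 1) : ℕ) : ℚ) * (G x D m : ℚ) / (((2 * D : ℕ) : ℚ)) ^ m
      = ∑ m ∈ range (c.M n), (G x D m : ℚ)
          * ((((m + (n - 1)).choose (n - 1) : ℕ) : ℚ) / (((2 * D : ℕ) : ℚ)) ^ m) := by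
    refine sum_congr rfl fun m _ => ?_; ring
  rw [hrhs, hre]
  change _ = ∑ i ∈ range (c.cnt n), _
  rw [Nat.cast_mul, Nat.cast_pow, Nat.cast_sum, Finset.mul_sum, Finset.sum_div]
  refine sum_congr rfl fun i hi => ?_
  rw [mem_range] at hi
  have hiK : i ≤ c.K := by omega
  rw [Nat.cast_mul, Nat.cast_mul, Nat.cast_pow, hwv i hiK, facSeq_getD _ _ _ hi]
  -- `C(m+n', n') = (m+n')!/(m! n'!)`
  have hch : ((((2 * i + c.A) + (n - 1)).choose (n - 1) : ℕ) : ℚ)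
      = (((2 * i + c.A) + (n - 1))! : ℚ) / ((((2 * i + c.A))! : ℚ) * (((n - 1))! : ℚ)) := by
    rw [eq_div_iff (by positivity), ← mul_assoc]
    exact_mod_cast Nat.add_choose_mul_factorial_mul_factorial (2 * i + c.A) (n - 1)
  rw [hch, show c.A + (n - 1) + 2 * i = 2 * i + c.A + (n - 1) by ring]
  have hpow := baseD_pow_bookkeeping hp (n := n) hcnt hi
  have h22' : (((2 * D : ℕ) : ℚ)) ^ (2 * i + c.A) ≠ 0 := pow_ne_zero _ hD0
  have h484a : ((baseD D : ℕ) : ℚ) ^ (c.K + 1 - c.cnt n) ≠ 0 := by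
    rw [baseD]; push_cast; exact pow_ne_zero _ (pow_ne_zero _ (by exact_mod_cast hD0))
  have h484b : ((baseD D : ℕ) : ℚ) ^ (c.cnt n - 1 - i) ≠ 0 := by
    rw [baseD]; push_cast; exact pow_ne_zero _ (pow_ne_zero _ (by exact_mod_cast hD0))
  have hf1 : (((2 * i + c.A))! : ℚ) ≠ 0 := by positivity
  have hf2 : (((n - 1))! : ℚ) ≠ 0 := by positivity
  have hf3 : ((c.Mh)! : ℚ) ≠ 0 := by positivity
  rw [← hpow]
  field_simp

/-- **`U_n` is the truncated walk sum** `Σ_{m<M n} C(m+n', n') G_D(m)/(2D)^m · E_{m+n'+1}(λ)`. [cite: FitznerVanDerHofstad2016NoBLE, §5.1.1 (5.4)–(5.5) pp. 1089–1090] -/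
theorem UqD_eq (hp : c.ParamsD D) (hcs : ∀ i, coordD x i = (((c.avalsD D).getD i 0 : ℕ) : ℤ))
    (n : ℕ) (hn1 : 1 ≤ n) (hn4 : n ≤ 4) :
    c.UqD D (c.whatD D) n = ∑ m ∈ range (c.M n),
      (((m + (n - 1)).choose (n - 1) : ℕ) : ℚ) * (G x D m : ℚ) / (((2 * D : ℕ) : ℚ)) ^ m
        * EQ (c.lamD D) (m + (n - 1) + 1) := by
  obtain ⟨hwl, hwv⟩ := whatD_spec hp hcs
  have hcnt := hp.cnt_le n hn1 hn4
  have hD0 : (((2 * D : ℕ) : ℚ)) ≠ 0 := by have := hp.hD; positivity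
  rw [UqD, NUD, denD, hornerB, hornerAuxB_eq _ _ _ _ (by rw [length_expSeq, hwl]; exact hcnt),
    length_expSeq, zero_mul, zero_add, prodRange_zero]
  have hre := sum_range_parity hcs D (c.M n)
    (fun m => (((m + (n - 1)).choose (n - 1) : ℕ) : ℚ) / (((2 * D : ℕ) : ℚ)) ^ m
      * EQ (c.lamD D) (m + (n - 1) + 1))
  rw [Asum_avalsD hp] at hre
  have hrhs : ∑ m ∈ range (c.M n),
      (((m + (n - 1)).choose (n - 1) : ℕ) : ℚ) * (G x D m : ℚ) / (((2 * D : ℕ) : ℚ)) ^ m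
        * EQ (c.lamD D) (m + (n - 1) + 1)
      = ∑ m ∈ range (c.M n), (G x D m : ℚ)
          * ((((m + (n - 1)).choose (n - 1) : ℕ) : ℚ) / (((2 * D : ℕ) : ℚ)) ^ m
            * EQ (c.lamD D) (m + (n - 1) + 1)) := by
    refine sum_congr rfl fun m _ => ?_; ring
  rw [hrhs, hre]
  change _ = ∑ i ∈ range (c.cnt n), _
  rw [Nat.cast_mul, Nat.cast_pow, Nat.cast_sum, Finset.mul_sum, Finset.sum_div]
  refine sum_congr rfl fun i hi => ?_
  rw [mem_range] at hi
  have hiK : i ≤ c.K := by omega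
  rw [Nat.cast_mul, Nat.cast_mul, Nat.cast_pow, hwv i hiK, expSeq_getD _ _ _ _ hi]
  have hch : ((((2 * i + c.A) + (n - 1)).choose (n - 1) : ℕ) : ℚ)
      = (((2 * i + c.A) + (n - 1))! : ℚ) / ((((2 * i + c.A))! : ℚ) * (((n - 1))! : ℚ)) := by
    rw [eq_div_iff (by positivity), ← mul_assoc]
    exact_mod_cast Nat.add_choose_mul_factorial_mul_factorial (2 * i + c.A) (n - 1)
  rw [hch, show c.A + (n - 1) + 2 * i = 2 * i + c.A + (n - 1) by ring]
  have hpow := baseD_pow_bookkeeping hp (n := n) hcnt hi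
  have h22' : (((2 * D : ℕ) : ℚ)) ^ (2 * i + c.A) ≠ 0 := pow_ne_zero _ hD0
  have h484a : ((baseD D : ℕ) : ℚ) ^ (c.K + 1 - c.cnt n) ≠ 0 := by
    rw [baseD]; push_cast; exact pow_ne_zero _ (pow_ne_zero _ (by exact_mod_cast hD0))
  have h484b : ((baseD D : ℕ) : ℚ) ^ (c.cnt n - 1 - i) ≠ 0 := by
    rw [baseD]; push_cast; exact pow_ne_zero _ (pow_ne_zero _ (by exact_mod_cast hD0))
  have hf1 : (((2 * i + c.A))! : ℚ) ≠ 0 := by positivity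
  have hf2 : (((n - 1))! : ℚ) ≠ 0 := by positivity
  have hf3 : ((c.Mh)! : ℚ) ≠ 0 := by positivity
  rw [← hpow]
  field_simp

/-- **`P_n` in `ℝ`**: `P_n = Σ_{m<M n} C(m+n',n') p_m(x; D)`. [cite: FitznerVanDerHofstad2016NoBLE, §5.1.1 (5.4)–(5.5) pp. 1089–1090] -/
theorem PqD_real (hp : c.ParamsD D) (hcs : ∀ i, coordD x i = (((c.avalsD D).getD i 0 : ℕ) : ℤ))
    (n : ℕ) (hn1 : 1 ≤ n) (hn4 : n ≤ 4) :
    ((c.PqD D (c.whatD D) n : ℚ) : ℝ) = ∑ m ∈ range (c.M n),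
      (((m + (n - 1)).choose (n - 1) : ℕ) : ℝ) * srwLaw D m x := by
  rw [PqD_eq hp hcs n hn1 hn4]
  push_cast
  refine sum_congr rfl fun m _ => ?_
  rw [srwLaw_eq_srwCount_div, srwCount]
  ring

/-- **`U_n` in `ℝ`**: `U_n = Σ_{m<M n} C(m+n',n') p_m(x; D) E_{m+n'+1}(λ)`. [cite: FitznerVanDerHofstad2016NoBLE, §5.1.1 (5.4)–(5.5) pp. 1089–1090] -/
theorem UqD_real (hp : c.ParamsD D) (hcs : ∀ i, coordD x i = (((c.avalsD D).getD i 0 : ℕ) : ℤ))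
    (n : ℕ) (hn1 : 1 ≤ n) (hn4 : n ≤ 4) :
    ((c.UqD D (c.whatD D) n : ℚ) : ℝ) = ∑ m ∈ range (c.M n),
      (((m + (n - 1)).choose (n - 1) : ℕ) : ℝ) * srwLaw D m x
        * expPartial (c.lamD D : ℝ) (m + (n - 1) + 1) := by
  rw [UqD_eq hp hcs n hn1 hn4]
  push_cast
  refine sum_congr rfl fun m _ => ?_
  rw [srwLaw_eq_srwCount_div, cast_EQ, srwCount]
  ring

end Cert

end Literature.Probability.FitznerVanDerHofstad2017.SeedCert
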